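import Literature.NumberTheory.EllipticCurves.Rank1Residual.Typed.WuthrichUpperBound
import Literature.NumberTheory.EllipticCurves.Rank1Residual.Dedup
import Literature.NumberTheory.EllipticCurves.SupersingularIrreducibleProofs
import Literature.NumberTheory.EllipticCurves.SemistableModPImageFiveProofs
import HarnessLib

/-!
# Class X6 (supersingular, semistable) — TYPED missing input (cell `b2b-bsdres`)

HONEST FRAMING (run/shared/lean/b2b/bsd-rank1-residual/): construction-shaped classes are TYPED
(missing input named; required output at `(E,p)` stated), NOT attempted; announced preprints enter
only as OPEN hypotheses; this is not "finishing BSD".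

**Class X6** (RESIDUAL-CASES §a.2 v3; `Rank1Residual.ClassX6 W p := GoodSS W p ∧ Semistable W ∧
(5 ≤ p ∨ a_3 = 0)`): good supersingular reduction at `p`, `E` semistable, `p ≥ 5` or `a_3 = 0`;
both ranks. Census v3: 3 pairs with `N < 2500` (all rank `0`, `p = 3`, `a_3 = 0`), 28 with
`N < 10⁴` (all rank `0`; `p = 3`: 23). Label: CONSTRUCTION-SHAPED with an ANNOUNCED discharge —
Burungale–Skinner–Tian–Wan, arXiv:2409.01350v2, Thm. 1.3 (Kobayashi's ± main conjecture for
semistable `E`) / Thm. 1.5 (`p`-part of the BSD formula, `r ≤ 1`, `E` semistable) — a PREPRINT (no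
DOI found, FRESHNESS 2026-08-18): OPEN hypothesis only, never cited as a theorem here.

**In print.** Rank `1`: Jetchev–Skinner–Wan, Camb. J. Math. 5 (2017) Thm. 1.2.1 (tree
`JetchevSkinnerWan2017.thm121_padicValRat_bsd_rank_one`, PUB*: "Let `E/ℚ` be semistable … `p ≥ 3` a
prime of good reduction with `ρ̄_{E,p}` irreducible; if `p = 3` assume `a_3(E) = 0` when `E` has
supersingular reduction at `3`. If `ord_{s=1} L(E,s) = 1` then `ord_p (L'(E,1)/(Reg(E/ℚ)·Ω_E)) =
ord_p (#Ш(E) ∏ c_ℓ(E))`"; census flag `JSW-ss`: its supersingular case imports Wan's ± divisibility)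
— so `X6.missingInputAt_of_analyticRank_eq_one` DISCHARGES the typed input in rank one at `p ≥ 3`
given (irr); (irr) is AUTOMATIC at an odd supersingular prime by Serre 1972 §1.11 Prop. 12 — the
tree THEOREM `hasIrreducibleModPGaloisRep_of_dvd_frobeniusTrace` (`SupersingularIrreducibleProofs`) —
and the primed versions below drop the binder. Rank `0`: Wuthrich, Doc. Math. 19 (2014) Prop. 21
gives `ord_p #Ш ≤ ord_p #Ш_an` at odd good `p` with Borel-or-surjective image
(`Typed.missingUpperBoundAt_of_wuthrich`); the ±-IMC LOWER bound (Eisenstein-congruence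
divisibility for Kobayashi's signed main conjecture; Kobayashi 2003 gives only the Kato-side
divisibility) is what is missing in print — announced by BSTW Thm. 1.3.

This file: `X6.MissingInputAt` (rank `0`, odd `p`, Borel-or-surjective image: `MissingLowerBoundAt`;
otherwise `MissingPPartAt`), the conditional class theorem, and the rank-one discharge from JSW.
APPEND (harvest seat 1 GEN 8, theorems only): at an X6 pair with `p ≠ 2` the image hypotheses are
AUTOMATIC from published theorems PROVED in the tree — `ClassX6.irr` (Serre 1972 §1.11 Prop. 12:
good supersingular ⇒ `E[p]` irreducible) and `ClassX6.surj` (Serre 1972 §5.4 Prop. 21 i) /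
Edixhoven 1997 Prop. 2.1: irreducible ∧ semistable ⇒ `ρ̄_{E,p}` surjective, tree theorem
`hasSurjectiveModNGaloisRep_of_hasIrreducibleModPGaloisRep_of_isSemistable`). Hence: in analytic
rank `0` at odd `p` the typed missing input IS the lower bound
(`X6.missingInputAt_iff_missingLowerBoundAt_of_analyticRank_eq_zero`, no image proviso); in analytic
rank `1` at `p ≥ 3` JSW delivers `BSD(E,p)` with NO (irr) binder (`X6.bsdp_of_analyticRank_eq_one'`);
and the one-sentence form `X6.bsdp_of_rankZero_lowerBound`: at `p ≥ 3`, `r_an ≤ 1`, granted JSW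
(PUB*, flag `JSW-ss`), Wuthrich Prop. 21, GZK and modularity, `BSD(E,p)` on X6 follows from the
rank-`0` signed-IMC lower bound ALONE. No label change (the lower bound is still not in print).
The class-wide closed statement is not a Literature statement; recorded in CLASSES.md.
-/

noncomputable section

open scoped Classical NumberField

open WeierstrassCurve Literature.NumberTheory.EllipticCurves
  Literature.NumberTheory.EllipticCurves.Rank1Residual
  Literature.NumberTheory.EllipticCurves.Wuthrich2014

namespace Literature.NumberTheory.EllipticCurves.Rank1Residual.Typed

/-- **X6 — the missing input at `(E, p)`, typed**: at a good supersingular prime of a semistable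
curve (`p ≥ 5` or `a_3 = 0`), in analytic rank `0` with `p` odd and Borel-or-surjective image
Wuthrich 2014 Prop. 21 supplies `ord_p #Ш ≤ ord_p #Ш_an`, so the missing input is the signed-IMC
lower bound `MissingLowerBoundAt` (announced: BSTW arXiv:2409.01350 Thm. 1.3, PRE); otherwise it is
the whole output `MissingPPartAt` — which in rank `1`, `p ≥ 3`, (irr) is DISCHARGED by JSW 2017
Thm. 1.2.1 (`X6.missingInputAt_of_analyticRank_eq_one`). Nothing asserted.
[cite: JetchevSkinnerWan2017, Thm. 1.2.1 (p. 370) (shape only; nothing asserted)] [cite: Wuthrich2014, Prop. 21 (p. 400) (shape only; nothing asserted)] [claim: BurungaleSkinnerTianWan2024, status: under-review] -/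
def X6.MissingInputAt (W : WeierstrassCurve ℚ) (p : ℕ) [Fact p.Prime] : Prop :=
  (W.analyticRank = 0 → p ≠ 2 → (Red W p ∨ Surj W p) → MissingLowerBoundAt W p) ∧
  (¬ (W.analyticRank = 0 ∧ p ≠ 2 ∧ (Red W p ∨ Surj W p)) → MissingPPartAt W p)

/-- **X6 conditional class theorem**: in analytic rank `≤ 1`, the typed missing input at an X6 pair
yields Miller's `BSD(E,p)`; the rank-`0` published half is Wuthrich's Prop. 21 (`hW`; good ⇒ not
additive). Standing named facts: GZK `hGZK`, modularity `hmod`.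
[cite: Wuthrich2014, Prop. 21 (p. 400)] [cite: Miller2011LMS, §1 and Def. 1.1] -/
theorem X6.bsdp_of_missingInputAt (hW : sha_dvd_analyticSha)
    (hGZK : rank_eq_analyticRank_of_analyticRank_le_one) (hmod : hasEntireLFunction_rat)
    (W : WeierstrassCurve ℚ) [W.IsElliptic] [W.IsGloballyMinimal] (p : ℕ) [Fact p.Prime]
    (hr : W.analyticRank ≤ 1) (hX : ClassX6 W p) (hmiss : X6.MissingInputAt W p) : BSDp W p := by
  by_cases hc : W.analyticRank = 0 ∧ p ≠ 2 ∧ (Red W p ∨ Surj W p)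
  · obtain ⟨h0, hp, himg⟩ := hc
    have hadd : ¬ ((W.baseChange ℚ_[p]).minimal ℤ_[p]).HasAdditiveReduction ℤ_[p] :=
      WeierstrassCurve.HasGoodReduction.not_hasAdditiveReduction (R := ℤ_[p]) hX.1.1
    exact bsdp_of_missingLowerBoundAt_of_wuthrich W p hW hGZK hmod hp h0 hadd himg
      (hmiss.1 h0 hp himg)
  · exact bsdp_of_missingPPartAt W p hGZK hr (hmiss.2 hc)

/-- **Rank one is in print (PUB*, flag `JSW-ss`)**: at an X6 pair with `p ≥ 3`, `ρ̄_{E,p}`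
irreducible and `ord_{s=1} L(E,s) = 1`, JSW Thm. 1.2.1 (`hJSW`, the cell's full transcription;
semistable over `𝓞 ℚ` ⇐ `Semistable W` by `semistable_iff_isSemistable_ringOfIntegers`; the
`p = 3` clause ⇐ `a_3 = 0`) delivers the typed input: product display ⇒ `PPart` ⇒ `MissingPPartAt`.
[cite: JetchevSkinnerWan2017, Thm. 1.2.1 (p. 370)] [cite: Miller2011LMS, Def. 1.1] -/
theorem X6.missingInputAt_of_analyticRank_eq_one
    (hJSW : JetchevSkinnerWan2017.thm121_padicValRat_bsd_rank_one)
    (hGZK : rank_eq_analyticRank_of_analyticRank_le_one) (hmod : hasEntireLFunction_rat)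
    (W : WeierstrassCurve ℚ) [W.IsElliptic] [W.IsGloballyMinimal] (p : ℕ) [Fact p.Prime]
    (hp : 3 ≤ p) (hX : ClassX6 W p) (hirr : Irr W p) (hr : W.analyticRank = 1) :
    X6.MissingInputAt W p := by
  obtain ⟨⟨hgood, _⟩, hsst, h5⟩ := hX
  have hr1 : W.analyticRank ≤ 1 := hr.le
  have hfin : Finite W.sha := (hGZK W hr1).2
  have hsstO : W.IsSemistable (𝓞 ℚ) := (semistable_iff_isSemistable_ringOfIntegers W).mp hsst
  have h3 : p = 3 → (3 : ℤ) ∣ W.frobeniusTrace 3 → W.frobeniusTrace 3 = 0 := by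
    rintro rfl -
    rcases h5 with h5 | h5
    · omega
    · exact h5
  have hdisp := hJSW W p hp hsstO hgood h3 hirr hr hfin
  have hP : PPart W p := (pPart_iff_productShape W p).mpr hdisp
  have hM : MissingPPartAt W p := missingPPartAt_of_pPart W p hmod hGZK hr1 hP
  refine ⟨fun h0 => absurd (h0 ▸ hr : (0 : ℕ) = 1) (by decide), fun _ => hM⟩

/-- Hence, in rank one at `p ≥ 3` with (irr), `BSD(E,p)` on X6 follows from JSW Thm. 1.2.1 (PUB*)
and GZK — no missing input. [cite: JetchevSkinnerWan2017, Thm. 1.2.1 (p. 370)] -/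
theorem X6.bsdp_of_analyticRank_eq_one
    (hJSW : JetchevSkinnerWan2017.thm121_padicValRat_bsd_rank_one) (hW : sha_dvd_analyticSha)
    (hGZK : rank_eq_analyticRank_of_analyticRank_le_one) (hmod : hasEntireLFunction_rat)
    (W : WeierstrassCurve ℚ) [W.IsElliptic] [W.IsGloballyMinimal] (p : ℕ) [Fact p.Prime]
    (hp : 3 ≤ p) (hX : ClassX6 W p) (hirr : Irr W p) (hr : W.analyticRank = 1) : BSDp W p :=
  X6.bsdp_of_missingInputAt hW hGZK hmod W p hr.le hX
    (X6.missingInputAt_of_analyticRank_eq_one hJSW hGZK hmod W p hp hX hirr hr)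

end Literature.NumberTheory.EllipticCurves.Rank1Residual.Typed

/-! ### APPEND (harvest seat 1 GEN 8): at an X6 pair the image hypotheses are automatic
(Serre 1972 §1.11 Prop. 12 and §5.4 Prop. 21 i), both PROVED in the tree) -/

namespace Literature.NumberTheory.EllipticCurves.Rank1Residual

variable (W : WeierstrassCurve ℚ) [W.IsElliptic] [W.IsGloballyMinimal] (p : ℕ) [Fact p.Prime]

/-- **X6 ⇒ irr(p) at `p ≠ 2`.** At an odd prime of good supersingular reduction `E[p]` is an
irreducible `Γ_ℚ`-module — Serre, Invent. Math. 15 (1972) §1.11 Prop. 12 (at a supersingular place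
of absolute ramification index `1` the inertia group acts on `E[p]` through a cyclic group of order
`p² - 1`, so `E[p]` is already an irreducible inertia-module); in the tree this is the THEOREM
`hasIrreducibleModPGaloisRep_of_dvd_frobeniusTrace` (good: `p ∤ Δ_min`; supersingular: `p ∣ a_p`).
[cite: Serre1972, §1.11 Prop. 12] -/
theorem ClassX6.irr (hp : p ≠ 2) (hX : ClassX6 W p) : Irr W p :=
  hasIrreducibleModPGaloisRep_of_dvd_frobeniusTrace W p hp
    (W.not_dvd_minimalDiscriminantInt_of_hasGoodReductionAtPrime' p hX.1.1) hX.1.2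

/-- **X6 ⇒ surj(p) at `p ≠ 2`.** `E` semistable with `E[p]` irreducible ⇒ `ρ̄_{E,p}` is onto
`GL₂(𝔽_p)` — Serre 1972 §5.4 Prop. 21 i) (= Edixhoven 1997 Prop. 2.1), the tree THEOREM
`hasSurjectiveModNGaloisRep_of_hasIrreducibleModPGaloisRep_of_isSemistable` (semistability over
`𝓞 ℚ` ⇐ the cell's primewise `Semistable` by `semistable_iff_isSemistable_ringOfIntegers`);
irreducibility from `ClassX6.irr`. [cite: Serre1972, §5.4 Prop. 21 i)] [cite: Edixhoven1997, Prop. 2.1 (PDF p. 285)] [cite: Serre1972, §1.11 Prop. 12] -/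
theorem ClassX6.surj (hp : p ≠ 2) (hX : ClassX6 W p) : Surj W p :=
  W.hasSurjectiveModNGaloisRep_of_hasIrreducibleModPGaloisRep_of_isSemistable
    ((semistable_iff_isSemistable_ringOfIntegers W).mp hX.2.1) p (ClassX6.irr W p hp hX)

/-- Hence an X6 pair with `p ≠ 2` is never Eisenstein: `¬ Red W p`. [cite: Serre1972, §1.11 Prop. 12] -/
theorem ClassX6.not_red (hp : p ≠ 2) (hX : ClassX6 W p) : ¬ Red W p :=
  fun h ↦ h (ClassX6.irr W p hp hX)

end Literature.NumberTheory.EllipticCurves.Rank1Residual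

namespace Literature.NumberTheory.EllipticCurves.Rank1Residual.Typed

variable (W : WeierstrassCurve ℚ) [W.IsElliptic] [W.IsGloballyMinimal] (p : ℕ) [Fact p.Prime]

/-- **X6, analytic rank `0`, odd `p`: the typed missing input IS the signed-IMC lower bound** — the
Borel-or-surjective proviso of `X6.MissingInputAt` holds by `ClassX6.surj` (Serre Props. 12, 21 i)),
so Wuthrich 2014 Prop. 21 applies at EVERY such pair and nothing but `MissingLowerBoundAt W p`
(the Eisenstein-congruence divisibility of Kobayashi's signed (±) IMC; announced by BSTW
arXiv:2409.01350 Thm. 1.3, PRE) is missing. Bookkeeping equivalence; nothing asserted.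
[cite: Serre1972, §5.4 Prop. 21 i)] [cite: Wuthrich2014, Prop. 21 (p. 400)] [cite: Miller2011LMS, Def. 1.1] -/
theorem X6.missingInputAt_iff_missingLowerBoundAt_of_analyticRank_eq_zero (hp : p ≠ 2)
    (hX : ClassX6 W p) (h0 : W.analyticRank = 0) :
    X6.MissingInputAt W p ↔ MissingLowerBoundAt W p := by
  have himg : Red W p ∨ Surj W p := Or.inr (ClassX6.surj W p hp hX)
  refine ⟨fun h ↦ h.1 h0 hp himg, fun hlow ↦ ⟨fun _ _ _ ↦ hlow, fun hc ↦ ?_⟩⟩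
  exact absurd ⟨h0, hp, himg⟩ hc

/-- **X6, analytic rank `0`, odd `p`: `BSD(E,p)` from the missing lower bound alone** — Wuthrich's
upper bound (`hW`, Prop. 21; image hypothesis automatic by `ClassX6.surj`) + `MissingLowerBoundAt`
⇒ the whole missing output ⇒ Miller's `BSD(E,p)` (GZK `hGZK`, modularity `hmod`).
[cite: Wuthrich2014, Prop. 21 (p. 400)] [cite: Serre1972, §5.4 Prop. 21 i)] [cite: Miller2011LMS, §1 and Def. 1.1] -/
theorem X6.bsdp_of_missingLowerBoundAt_of_analyticRank_eq_zero (hW : sha_dvd_analyticSha)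
    (hGZK : rank_eq_analyticRank_of_analyticRank_le_one) (hmod : hasEntireLFunction_rat)
    (hp : p ≠ 2) (hX : ClassX6 W p) (h0 : W.analyticRank = 0) (hlow : MissingLowerBoundAt W p) :
    BSDp W p :=
  X6.bsdp_of_missingInputAt hW hGZK hmod W p (by omega) hX
    ((X6.missingInputAt_iff_missingLowerBoundAt_of_analyticRank_eq_zero W p hp hX h0).mpr hlow)

/-- **Rank one, `p ≥ 3`, NO (irr) binder**: `X6.missingInputAt_of_analyticRank_eq_one` with the
irreducibility hypothesis of JSW Thm. 1.2.1 discharged by Serre's Prop. 12 (`ClassX6.irr`).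
[cite: JetchevSkinnerWan2017, Thm. 1.2.1 (p. 370)] [cite: Serre1972, §1.11 Prop. 12] -/
theorem X6.missingInputAt_of_analyticRank_eq_one'
    (hJSW : JetchevSkinnerWan2017.thm121_padicValRat_bsd_rank_one)
    (hGZK : rank_eq_analyticRank_of_analyticRank_le_one) (hmod : hasEntireLFunction_rat)
    (hp : 3 ≤ p) (hX : ClassX6 W p) (hr : W.analyticRank = 1) : X6.MissingInputAt W p :=
  X6.missingInputAt_of_analyticRank_eq_one hJSW hGZK hmod W p hp hX
    (ClassX6.irr W p (by omega) hX) hr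

/-- **X6 ∩ {r_an = 1} at `p ≥ 3`: `BSD(E,p)` from JSW Thm. 1.2.1 (PUB*, flag `JSW-ss`) + GZK, with
NO image binder** (Serre Prop. 12 discharges (irr)). [cite: JetchevSkinnerWan2017, Thm. 1.2.1 (p. 370)] [cite: Serre1972, §1.11 Prop. 12] -/
theorem X6.bsdp_of_analyticRank_eq_one'
    (hJSW : JetchevSkinnerWan2017.thm121_padicValRat_bsd_rank_one) (hW : sha_dvd_analyticSha)
    (hGZK : rank_eq_analyticRank_of_analyticRank_le_one) (hmod : hasEntireLFunction_rat)
    (hp : 3 ≤ p) (hX : ClassX6 W p) (hr : W.analyticRank = 1) : BSDp W p :=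
  X6.bsdp_of_analyticRank_eq_one hJSW hW hGZK hmod W p hp hX (ClassX6.irr W p (by omega) hX) hr

/-- **X6 at `p ≥ 3` in ONE sentence.** In analytic rank `≤ 1`, granted the PUBLISHED inputs JSW 2017
Thm. 1.2.1 (`hJSW`, PUB*, flag `JSW-ss`), Wuthrich 2014 Prop. 21 (`hW`), GZK (`hGZK`) and modularity
(`hmod`), `BSD(E,p)` at an X6 pair follows from the rank-`0` signed-IMC LOWER bound ALONE
(`hlow`, needed only when `r_an = 0`): every image hypothesis is automatic (Serre Props. 12, 21 i)).
This is the exact typed residue of X6 at odd `p`; the lower bound is NOT in print (announced: BSTW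
arXiv:2409.01350 Thm. 1.3, PRE) — no label change.
[cite: JetchevSkinnerWan2017, Thm. 1.2.1 (p. 370)] [cite: Wuthrich2014, Prop. 21 (p. 400)] [cite: Serre1972, §1.11 Prop. 12 and §5.4 Prop. 21 i)] [cite: Miller2011LMS, §1 and Def. 1.1] -/
theorem X6.bsdp_of_rankZero_lowerBound
    (hJSW : JetchevSkinnerWan2017.thm121_padicValRat_bsd_rank_one) (hW : sha_dvd_analyticSha)
    (hGZK : rank_eq_analyticRank_of_analyticRank_le_one) (hmod : hasEntireLFunction_rat)
    (hp : 3 ≤ p) (hX : ClassX6 W p) (hr : W.analyticRank ≤ 1)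
    (hlow : W.analyticRank = 0 → MissingLowerBoundAt W p) : BSDp W p := by
  rcases Nat.eq_zero_or_pos W.analyticRank with h0 | hpos
  · exact X6.bsdp_of_missingLowerBoundAt_of_analyticRank_eq_zero W p hW hGZK hmod (by omega) hX h0
      (hlow h0)
  · exact X6.bsdp_of_analyticRank_eq_one' W p hJSW hW hGZK hmod hp hX (by omega)

/-- Conversely, at `p ≥ 3` the typed input `X6.MissingInputAt` in analytic rank `≤ 1` is EQUIVALENT,
granted the same published inputs, to "`r_an = 0 →` lower bound": in rank `1` it holds outright
(JSW), in rank `0` it is the lower bound. Bookkeeping. [cite: JetchevSkinnerWan2017, Thm. 1.2.1 (p. 370)] [cite: Serre1972, §1.11 Prop. 12 and §5.4 Prop. 21 i)] [cite: Miller2011LMS, Def. 1.1] -/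
theorem X6.missingInputAt_iff_rankZero_lowerBound
    (hJSW : JetchevSkinnerWan2017.thm121_padicValRat_bsd_rank_one)
    (hGZK : rank_eq_analyticRank_of_analyticRank_le_one) (hmod : hasEntireLFunction_rat)
    (hp : 3 ≤ p) (hX : ClassX6 W p) (hr : W.analyticRank ≤ 1) :
    X6.MissingInputAt W p ↔ (W.analyticRank = 0 → MissingLowerBoundAt W p) := by
  rcases Nat.eq_zero_or_pos W.analyticRank with h0 | hpos
  · rw [X6.missingInputAt_iff_missingLowerBoundAt_of_analyticRank_eq_zero W p (by omega) hX h0]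
    exact ⟨fun h _ ↦ h, fun h ↦ h h0⟩
  · have h1 : W.analyticRank = 1 := by omega
    exact ⟨fun _ h0 ↦ by omega,
      fun _ ↦ X6.missingInputAt_of_analyticRank_eq_one' W p hJSW hGZK hmod hp hX h1⟩

/-! ## Addendum (cell seat `b2b-bsdres-harvest-1`, gen 18, 2026-08-20) — rank one WITHOUT the PUB* input

The rank-one discharge above (`X6.missingInputAt_of_analyticRank_eq_one[']`,
`X6.bsdp_of_analyticRank_eq_one[']`, `X6.bsdp_of_rankZero_lowerBound`,
`X6.missingInputAt_iff_rankZero_lowerBound`) takes Jetchev–Skinner–Wan 2017 Thm. 1.2.1, whose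
supersingular case carries the census flag `JSW-ss` (PUB*: it imports X. Wan's ± divisibility,
preprint arXiv:1411.6352, withdrawn from publication per Burungale–Skinner–Tian–Wan
arXiv:2409.01350v2 Rem. 1.4 (i)). A REFEREED one-sided alternative is now in the tree:
Sprung, Adv. Math. 449 (2024) 109741, Cor. 1.3, second sentence (named fact
`Sprung2024.cor13_padicValRat_bsd_rank_one_le`, file
`Literature/NumberTheory/EllipticCurves/Sprung2024/ChromaticRankOneOneSided.lean`; flags
`Sprung24-Cor13-via-Kob13`, `KOB13-primary-unread`): for `E/ℚ` with square-free conductor at an odd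
supersingular prime, `ord_{s=1} L(E,s) = 1 ⇒ ord_p #Ш ≤ ord_p #Ш_an`. Since `ClassX6 ⇒ Semistable`,
it applies on the whole class; the consequences are proved in
`Summits/BirchSwinnertonDyer/Rank1Residual/Supersingular/X6RankOneOneSided.lean` (p209700):
`X6.missingUpperBoundAt_of_analyticRank_eq_one`, and
**`X6.missingInputAt_iff_missingLowerBoundAt` — at an odd prime, in analytic rank `≤ 1`, the typed
missing input of this file is EXACTLY `MissingLowerBoundAt W p` in BOTH ranks, from refereed inputs
only** (rank `0`: Wuthrich Prop. 21 via `ClassX6.surj`; rank `1`: Sprung Cor. 1.3 (ii)); per pair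
`X6.bsdp_of_analyticRank_eq_one_of_shaAn_le` (`r_an = 1` and an exact `p`-adic unit `#Ш_an` ⇒
`BSD(E,p)`). JSW Thm. 1.2.1 remains the class-level cover of record for X6 ∩ {r_an = 1}; where
`p ∣ #Ш_an` in rank one the residue is `MissingLowerBoundAt` (census, Cremona range `N < 5·10⁵`:
42 such pairs, all at `p = 3` with `#Ш_an = 9`, none with `N < 2·10⁴`;
`HOME/b2b-bsdres-harvest-1/g18/x6r1/`). Nothing in this addendum asserts anything about a curve;
no declaration of this file is changed. [cite: Sprung2024, Cor. 1.3 (p. 5), second sentence]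
[cite: JetchevSkinnerWan2017, Thm. 1.2.1 (p. 370)] [claim: BurungaleSkinnerTianWan2024, status: under-review] -/

end Literature.NumberTheory.EllipticCurves.Rank1Residual.Typed
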